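import Summits.QuantumFields.BalabanUV.Beta.D1BFx.GluonNeedleSplit
import Summits.QuantumFields.BalabanUV.Beta.D1BFx.NeedlePotentialLetters
import Summits.QuantumFields.BalabanUV.Beta.D1BFx.RankOneBubbleJets
import Summits.QuantumFields.BalabanUV.Beta.D1BFx.ProjectorColumnSharp
import Summits.QuantumFields.BalabanUV.Beta.D1BFx.RColumnProfile
import Summits.QuantumFields.BalabanUV.Beta.D1BFx.GluonLegTails

/-!
# `BalabanUV.Beta.D1BFx.NeedleNdlShape` — road «BF-x» for binder row D1, slot (K), END row `hGrp gN`, «GN-NDL-SHAPE»: THE NEEDLE ⊗ COLUMN PIECE AS A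
# DIFFERENCE OF TWO RANK-ONE TENSORS UNDER `dSw` — `ndlPiece n a cQ κ u = dSw (tensor C_u row_u − tensor row_u C_u) = outer (∇C_u) (∇row_u) − outer (∇row_u) (∇C_u)`
# (`row_u = NeedlePotentialLetters.ndlRow n a κ u`, `C_u q = cQ·Σ_{z∈B(blk u)} Pgt z q − kerP q (blk u)` the combined column), the localisation of the two
# factors, and the WORD SHAPES of the needle cells of T₃∕T₂∕T₁ (`ndl ⊗ proj`, `proj ⊗ ndl`, `ndl ⊗ dSw(f⊗g)`) as explicit pairings — the last structural input
# of the owner's claim table «GN-CELLS» (GLUON-NEEDLE-ROWS v0.2)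

HONEST DEPENDENCY (cell records, verbatim): «continuum YM on T⁴ ⇐ BetaPertH ∧ nine spine estimates (0/9 proved); BetaPertH ⇐ (D1) ∧ (D4) ∧
CAP+tail; G-an2-4 gates asym, D1 and NE2/3/4.»  HONEST FRAMING (cell contract, verbatim): «discharging `BetaPertH` makes Bałaban's UV stability
UNCONDITIONAL — a real constructive-QFT result; it is NOT the continuum limit and NOT the Clay problem.»  THIS MODULE DISCHARGES NOTHING of the
wall: [folklore] kernel algebra BY NAME over gan24-leaf-05's `GluonNeedleSplit.ndlPiece_apply`, leaf-04-g6's `CornerVBlockRank.cornerV_qAnti_apply_road`,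
`CornerJRankOne.cornerJ_apply_eq`, the owner's «GN-𝔅» (`RankOneBubbleJets.dSw_tensor`, `bubble_dSw_dSw`, `bubble_dSw_dJetSw`, `RankOneBubble.loc_outer` …) and the
letters `NeedlePotentialLetters.abs_ndlRow_le`, `ProjectorColumnSharp.abs_combinedColumn_le_sup`, `RColumnProfile.nrm_sub_le` for the localisation.  No `def`,
no `def … : Prop`, nothing cited, 0 sorry.  Asserts NO bound on any cell.  Root-level binders hW ∕ hR-sockets ∕ hSX-socket ∕ D1Tel ∕ D1Rep — 0 discharged;
(K) NOT closed; NOT D1, NOT `BetaPertH`, NOT continuum, NOT Clay.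

ABSOLUTE RULE (cell charter, verbatim): «No internally-minted statement may enter as a cited fact. Every hypothesis is either kernel-proved in
this package or a verbatim quotation of a PUBLISHED theorem with page reference. The manuscript(s) under audit are NOT citable for their own
disputed steps — they are the thing under adjudication; programme-internal (2001/route/tribunal) claims are never citable.»

CONTENT (`a > 0`, `n ≥ 1`; `C_u` is written inline as a lambda, no definition).
* §1 [folklore] **`ndlPiece_eq_dSw_tensor`**, **`ndlPiece_eq_outer`** (`= outer (grad C_u) (grad row_u) − outer (grad row_u) (grad C_u)`).
* §2 [folklore] `locV_of_blockDecay` (block decay ⇒ `LocV`, via `nrm_sub_le` and `l1 ≤ 4‖·‖∞`), `locV_ndlRow`, `locV_combinedColumn`, `loc_ndlPiece'`.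
* §3 [folklore] the word shapes over ONE spread leg `A` and a spread site kernel `Y` (the projector): **`bubble_ndl_dJetSw`** (`ndl ⊗ proj`: four explicit products of a pairing
  and a point value), **`bubble_ndl_dSw`** (`ndl ⊗ dSw(f⊗g)`: two `bubble_dSw_dSw` products — the building block of `ndl ⊗ dip`, `ndl ⊗ ndl`, `ndl ⊗ SbT`-free cells).
NOT HERE (honest): any estimate; the `proj ⊗ ndl` mirror is `bubble_ndl_dJetSw` after `FineHessianSectors.biBubbleTable_transpose`.
Unit `b2b-balaban-beta-d1-p2` (gen 10), road «BF-x» OWNER; `LEAVES-BFx.md` row (N) «GN-NDL-SHAPE».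
-/

noncomputable section

namespace Summit.QuantumFields.BalabanUV.Beta.D1BFx.NeedleNdlShape

open Finset
open scoped BigOperators
open Literature.MathematicalPhysics.QuantumFieldTheory.Balaban1983to89
open Literature.MathematicalPhysics.QuantumFieldTheory.Balaban1983to89.Beta
open B12Sec2to5 (l1 l1_nonneg)
open B6QGQLower276 (X blk B mem_B)
open ExpKernelCalculus (Site MKer Decays bubble)
open DyadicShell (Pt supNorm)
open AffineAveraging (unitVec)
open Summit.QuantumFields.BalabanUV.Beta.TameKernelCalculus (Spr Loc trK trK_apply)
open Summit.QuantumFields.BalabanUV.Beta.D1BFx.RProjector (Pgt kerP deltaPP deltaP deltaPP_pos deltaP_pos)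
open Summit.QuantumFields.BalabanUV.Beta.D1BFx.ProjectorSupNorm (cPPs cPs cPPs_nonneg cPs_nonneg)
open Summit.QuantumFields.BalabanUV.Beta.D1BFx.ProjectorColumnSharp (abs_combinedColumn_le_sup)
open Summit.QuantumFields.BalabanUV.Beta.D1BFx.GhostLeg (Ggh)
open Summit.QuantumFields.BalabanUV.Beta.D1BFx.GhostStencil (qAnti)
open Summit.QuantumFields.BalabanUV.Beta.D1BFx.RProjectorJet (RG cornerV cornerJ Jq)
open Summit.QuantumFields.BalabanUV.Beta.D1BFx.RJetAssembly (dSw dJetSw)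
open Summit.QuantumFields.BalabanUV.Beta.D1BFx.CornerVBlockRank (cornerV_qAnti_apply_road)
open Summit.QuantumFields.BalabanUV.Beta.D1BFx.CornerJRankOne (cornerJ_apply_eq)
open Summit.QuantumFields.BalabanUV.Beta.D1BFx.SbRblkAnatomy (dSw_congr)
open Summit.QuantumFields.BalabanUV.Beta.D1BFx.GluonNeedleSplit (ndlPiece ndlPiece_apply dSw_sub)
open Summit.QuantumFields.BalabanUV.Beta.D1BFx.NeedlePotentialLetters (ndlRow ndlRow_def abs_ndlRow_le)
open Summit.QuantumFields.BalabanUV.Beta.D1BFx.RColumnBlockMass (dR cR dR_pos cR_nonneg)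
open Summit.QuantumFields.BalabanUV.Beta.D1BFx.RColumnProfile (nrm_sub_le)
open Summit.QuantumFields.BalabanUV.Beta.D1BFx.GluonLegTails (l1_le_four_mul_supNorm)
open Summit.QuantumFields.BalabanUV.Beta.D1BFx.GhostLegFree (supNorm_eq)
open Summit.QuantumFields.BalabanUV.Beta.D1BFx.RankOneBubble (outer applyK applyKT pairing LocV loc_outer bubble_outer_sub_left bubble_outer_sub_right)
open Summit.QuantumFields.BalabanUV.Beta.D1BFx.RankOneBubbleJets (grad tensor bondInd colGrad rowGrad dSw_tensor locV_grad_of_locV bubble_dSw_dSw bubble_dSw_dJetSw)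

variable (n : ℕ) [NeZero n] (a cQ : ℝ) (κ : Fin 4) (u : Site 4)

/-! ## §1 The needle ⊗ column piece as a difference of two tensors under `dSw` -/

/-- [folklore] **«GN-NDL-SHAPE»**: `ndlPiece n a cQ κ u = dSw (tensor C_u row_u − tensor row_u C_u)` with `row_u = ndlRow n a κ u` and the combined column
`C_u q = cQ·Σ_{z∈B(blk u)} Pgt z q − kerP q (blk u)` (from `cornerV_qAnti_apply_road`: `cornerV…qAnti x q = −row_u(x)·Σ_z Pgt z q` and `cornerJ_apply_eq`:
`cornerJ… x q = −row_u(x)·kerP q (blk u)`). -/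
theorem ndlPiece_eq_dSw_tensor (ha : 0 < a) :
    ndlPiece n a cQ κ u =
      dSw (tensor (fun q => cQ * (∑ z ∈ B (n - 1) (blk (n - 1) u), Pgt n a z q () ()) - kerP (d := 4) (n - 1) a q (blk (n - 1) u)) (ndlRow n a κ u)
        - tensor (ndlRow n a κ u) (fun q => cQ * (∑ z ∈ B (n - 1) (blk (n - 1) u), Pgt n a z q () ()) - kerP (d := 4) (n - 1) a q (blk (n - 1) u))) := by
  rw [ndlPiece_apply]
  congr 1
  funext x q v w
  obtain ⟨⟩ := v; obtain ⟨⟩ := w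
  simp only [Pi.sub_apply, Pi.smul_apply, smul_eq_mul, trK_apply, tensor, ndlRow_def]
  rw [cornerV_qAnti_apply_road n a κ u ha x q () (), cornerV_qAnti_apply_road n a κ u ha q x () (),
    cornerJ_apply_eq n a κ u (Ggh n a) (Pgt n a) x q () (), cornerJ_apply_eq n a κ u (Ggh n a) (Pgt n a) q x () ()]
  ring

/-- [folklore] **THE NEEDLE ⊗ COLUMN PIECE AS TWO RANK-ONE BOND KERNELS**: `ndlPiece = outer (∇C_u) (∇row_u) − outer (∇row_u) (∇C_u)`. -/
theorem ndlPiece_eq_outer (ha : 0 < a) :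
    ndlPiece n a cQ κ u =
      outer (grad (fun q => cQ * (∑ z ∈ B (n - 1) (blk (n - 1) u), Pgt n a z q () ()) - kerP (d := 4) (n - 1) a q (blk (n - 1) u))) (grad (ndlRow n a κ u))
        - outer (grad (ndlRow n a κ u)) (grad (fun q => cQ * (∑ z ∈ B (n - 1) (blk (n - 1) u), Pgt n a z q () ()) - kerP (d := 4) (n - 1) a q (blk (n - 1) u))) := by
  rw [ndlPiece_eq_dSw_tensor n a cQ κ u ha, dSw_sub, dSw_tensor, dSw_tensor]

/-! ## §2 Localisation of the two factors -/

/-- [folklore] **BLOCK DECAY ⟹ `LocV`**: `|f x| ≤ M·e^{−δ·dist(blk x, blk u)}` for all `x` (`δ > 0`) ⟹ `LocV (fun x _ => f x)` (rate `δ∕(4n)`, constant `M·e^{δ}`;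
`‖x−u‖∞ ≤ n·(dist(blk x, blk u) + 1)` by `RColumnProfile.nrm_sub_le`, `|·|₁ ≤ 4‖·‖∞`). -/
theorem locV_of_blockDecay {F : Type*} {f : Site 4 → ℝ} {M δ : ℝ} (hδ : 0 < δ)
    (h : ∀ x : Site 4, |f x| ≤ M * Real.exp (-(δ * dist (blk (n - 1) x) (blk (n - 1) u)))) : LocV (fun (x : Site 4) (_ : F) => f x) := by
  have hn : (0 : ℝ) < n := by exact_mod_cast Nat.pos_of_ne_zero (NeZero.ne n)
  have hM : 0 ≤ M := by
    have h0 := h u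
    rw [dist_self, mul_zero, neg_zero, Real.exp_zero, mul_one] at h0
    exact (abs_nonneg _).trans h0
  refine ⟨u, M * Real.exp δ, δ / (4 * n), by positivity, fun x _ => (h x).trans ?_⟩
  have hnrm : (supNorm (x - u) : ℝ) ≤ (n : ℝ) * (dist (blk (n - 1) x) (blk (n - 1) u) + 1) := by
    have h1 := nrm_sub_le n x u
    have h2 : (supNorm (x - u) : ℝ) ≤ Beta.PoissonInterior.nrm (x - u) := by
      rw [supNorm_eq]; exact Beta.PoissonInterior.supNorm_le_nrm _
    exact h2.trans h1
  have hl1 : l1 (x - u) ≤ 4 * (supNorm (x - u) : ℝ) := l1_le_four_mul_supNorm (x - u)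
  rw [mul_assoc, ← Real.exp_add]
  refine mul_le_mul_of_nonneg_left (Real.exp_le_exp.2 ?_) hM
  -- `−δ·D ≤ δ − (δ∕(4n))·|x−u|₁` from `|x−u|₁ ≤ 4n(D+1)`
  have hD : l1 (x - u) ≤ 4 * ((n : ℝ) * (dist (blk (n - 1) x) (blk (n - 1) u) + 1)) := hl1.trans (by nlinarith)
  have key : δ / (4 * n) * l1 (x - u) ≤ δ * (dist (blk (n - 1) x) (blk (n - 1) u) + 1) := by
    calc δ / (4 * n) * l1 (x - u) ≤ δ / (4 * n) * (4 * ((n : ℝ) * (dist (blk (n - 1) x) (blk (n - 1) u) + 1))) :=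
          mul_le_mul_of_nonneg_left hD (by positivity)
      _ = δ * (dist (blk (n - 1) x) (blk (n - 1) u) + 1) := by field_simp
  linarith

/-- [folklore] the needle potential is a localised bond function (block decay `n⁻⁴·cR·e^{−dR·d}` of PART 2c). -/
theorem locV_ndlRow (ha : 0 < a) : LocV (fun (x : Site 4) (_ : Fin 4) => ndlRow n a κ u x) :=
  locV_of_blockDecay n u (F := Fin 4) (M := ((n : ℝ) ^ 4)⁻¹ * cR a) (dR_pos ha) fun x => by
    have h := abs_ndlRow_le n κ u ha x; rwa [← mul_assoc] at h

/-- [folklore] the combined column is a localised bond function (`abs_combinedColumn_le_sup`, both decays at the rate `min δ_PP δ_P`). -/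
theorem locV_combinedColumn (ha : 0 < a) :
    LocV (fun (q : Site 4) (_ : Fin 4) => cQ * (∑ z ∈ B (n - 1) (blk (n - 1) u), Pgt n a z q () ()) - kerP (d := 4) (n - 1) a q (blk (n - 1) u)) := by
  have hPP := deltaPP_pos 4 ha; have hP := deltaP_pos 4 ha
  set δ := min (deltaPP 4 a) (deltaP 4 a) with hδ
  have hδ0 : 0 < δ := lt_min hPP hP
  refine locV_of_blockDecay n u (F := Fin 4) (M := |cQ| * cPPs 4 a + cPs 4 a) hδ0 fun q => ?_
  have h := abs_combinedColumn_le_sup n ha cQ q (blk (n - 1) u) () ()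
  refine h.trans ?_
  have hd : 0 ≤ dist (blk (n - 1) q) (blk (n - 1) u) := dist_nonneg
  have e1 : Real.exp (-(deltaPP 4 a * dist (blk (n - 1) u) (blk (n - 1) q))) ≤ Real.exp (-(δ * dist (blk (n - 1) q) (blk (n - 1) u))) := by
    rw [dist_comm]; exact Real.exp_le_exp.2 (by nlinarith [min_le_left (deltaPP 4 a) (deltaP 4 a)])
  have e2 : Real.exp (-(deltaP 4 a * dist (blk (n - 1) q) (blk (n - 1) u))) ≤ Real.exp (-(δ * dist (blk (n - 1) q) (blk (n - 1) u))) :=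
    Real.exp_le_exp.2 (by nlinarith [min_le_right (deltaPP 4 a) (deltaP 4 a)])
  have hc1 : 0 ≤ |cQ| * cPPs 4 a := mul_nonneg (abs_nonneg _) (cPPs_nonneg 4 ha)
  have hc2 := cPs_nonneg 4 ha
  calc |cQ| * (cPPs 4 a * Real.exp (-(deltaPP 4 a * dist (blk (n - 1) u) (blk (n - 1) q))))
        + cPs 4 a * Real.exp (-(deltaP 4 a * dist (blk (n - 1) q) (blk (n - 1) u)))
      ≤ |cQ| * cPPs 4 a * Real.exp (-(δ * dist (blk (n - 1) q) (blk (n - 1) u))) + cPs 4 a * Real.exp (-(δ * dist (blk (n - 1) q) (blk (n - 1) u))) := by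
        rw [← mul_assoc]; exact add_le_add (mul_le_mul_of_nonneg_left e1 hc1) (mul_le_mul_of_nonneg_left e2 hc2)
    _ = (|cQ| * cPPs 4 a + cPs 4 a) * Real.exp (-(δ * dist (blk (n - 1) q) (blk (n - 1) u))) := by ring

/-- [folklore] `ndlPiece` is localised, read off its rank-one form (the tree's `GluonNeedleSplit.loc_ndlPiece` by another route). -/
theorem loc_ndlPiece' (ha : 0 < a) : Loc (ndlPiece n a cQ κ u) := by
  rw [ndlPiece_eq_outer n a cQ κ u ha]
  have hr := locV_grad_of_locV (locV_ndlRow n a κ u ha)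
  have hc := locV_grad_of_locV (locV_combinedColumn n a cQ u ha)
  exact (loc_outer hc hr).sub (loc_outer hr hc)

/-! ## §3 The word shapes of the needle cells -/

variable {n a cQ κ u}

/-- [folklore] **`ndl ⊗ proj` (THE NP CELL's WORD), over one spread leg `A` and a spread site kernel `Y`**: with `C = C_u`, `ρ = row_u`, `c′ = ∇_col Y(·, u′⁺)`,
`r′ = ∇_row Y(u′⁺, ·)`, `u′⁺ = u′ + e_κ′`:
`bubble A (ndlPiece n a cQ κ u) (dJetSw κ′ u′ Y) = [⟨∇ρ, A c′⟩·(A∇C)(u′,κ′) − (∇ρ A)(u′,κ′)·⟨A∇C, r′⟩] − [⟨∇C, A c′⟩·(A∇ρ)(u′,κ′) − (∇C A)(u′,κ′)·⟨A∇ρ, r′⟩]`. -/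
theorem bubble_ndl_dJetSw (ha : 0 < a) {A : MKer 4 (Fin 4)} (hA : Spr A) {Y : MKer 4 Unit} (hY : Spr Y) (κ' : Fin 4) (u' : Site 4) :
    bubble A (ndlPiece n a cQ κ u) (dJetSw κ' u' Y) =
      (pairing (grad (ndlRow n a κ u)) (applyK A (colGrad Y (u' + unitVec κ')))
          * applyK A (grad (fun q => cQ * (∑ z ∈ B (n - 1) (blk (n - 1) u), Pgt n a z q () ()) - kerP (d := 4) (n - 1) a q (blk (n - 1) u))) u' κ'
        - applyKT (grad (ndlRow n a κ u)) A u' κ'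
          * pairing (applyK A (grad (fun q => cQ * (∑ z ∈ B (n - 1) (blk (n - 1) u), Pgt n a z q () ()) - kerP (d := 4) (n - 1) a q (blk (n - 1) u))))
              (rowGrad Y (u' + unitVec κ')))
      - (pairing (grad (fun q => cQ * (∑ z ∈ B (n - 1) (blk (n - 1) u), Pgt n a z q () ()) - kerP (d := 4) (n - 1) a q (blk (n - 1) u)))
            (applyK A (colGrad Y (u' + unitVec κ'))) * applyK A (grad (ndlRow n a κ u)) u' κ'
        - applyKT (grad (fun q => cQ * (∑ z ∈ B (n - 1) (blk (n - 1) u), Pgt n a z q () ()) - kerP (d := 4) (n - 1) a q (blk (n - 1) u))) A u' κ'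
          * pairing (applyK A (grad (ndlRow n a κ u))) (rowGrad Y (u' + unitVec κ'))) := by
  have hr := locV_ndlRow n a κ u ha
  have hc := locV_combinedColumn n a cQ u ha
  have hP : Loc (dJetSw κ' u' Y) := by
    obtain ⟨C, δ, hδ, hYd⟩ := hY
    exact ⟨u', u', _, δ, hδ, RJetAssembly.biLoc_dJetSw_of_decays κ' u' hδ.le hYd⟩
  rw [ndlPiece_eq_dSw_tensor n a cQ κ u ha, dSw_sub,
    KernelWardRelative.bubble_sub_left hA (RankOneBubbleJets.loc_dSw_tensor hc hr) (RankOneBubbleJets.loc_dSw_tensor hr hc) hP,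
    bubble_dSw_dJetSw hA hY hc hr κ' u', bubble_dSw_dJetSw hA hY hr hc κ' u']

/-- [folklore] **`ndl ⊗ dSw(f ⊗ g)`** (the building block of the NK, NN and `ndl ⊗ SbRblk`-type cells), over one spread leg `A`, for localised site functions `f`, `g`:
`bubble A (ndlPiece n a cQ κ u) (dSw (tensor f g)) = ⟨∇ρ, A∇f⟩·⟨A∇C, ∇g⟩ − ⟨∇C, A∇f⟩·⟨A∇ρ, ∇g⟩`. -/
theorem bubble_ndl_dSw (ha : 0 < a) {A : MKer 4 (Fin 4)} (hA : Spr A) {f g : Site 4 → ℝ} (hf : LocV (fun x (_ : Fin 4) => f x))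
    (hg : LocV (fun x (_ : Fin 4) => g x)) :
    bubble A (ndlPiece n a cQ κ u) (dSw (tensor f g)) =
      pairing (grad (ndlRow n a κ u)) (applyK A (grad f))
          * pairing (applyK A (grad (fun q => cQ * (∑ z ∈ B (n - 1) (blk (n - 1) u), Pgt n a z q () ()) - kerP (d := 4) (n - 1) a q (blk (n - 1) u)))) (grad g)
        - pairing (grad (fun q => cQ * (∑ z ∈ B (n - 1) (blk (n - 1) u), Pgt n a z q () ()) - kerP (d := 4) (n - 1) a q (blk (n - 1) u))) (applyK A (grad f))
          * pairing (applyK A (grad (ndlRow n a κ u))) (grad g) := by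
  have hr := locV_ndlRow n a κ u ha
  have hc := locV_combinedColumn n a cQ u ha
  rw [ndlPiece_eq_dSw_tensor n a cQ κ u ha, dSw_sub,
    KernelWardRelative.bubble_sub_left hA (RankOneBubbleJets.loc_dSw_tensor hc hr) (RankOneBubbleJets.loc_dSw_tensor hr hc)
      (RankOneBubbleJets.loc_dSw_tensor hf hg),
    RankOneBubbleJets.bubble_dSw_dSw, RankOneBubbleJets.bubble_dSw_dSw]

end Summit.QuantumFields.BalabanUV.Beta.D1BFx.NeedleNdlShape

end
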